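import Summits.QuantumFields.BalabanUV.Beta.MultiscaleLaplacianMember
import Summits.QuantumFields.BalabanUV.Beta.MultiscaleSupMember
import Summits.QuantumFields.BalabanUV.Beta.MultiscaleNestedGrading

/-!
# `Summit.QuantumFields.BalabanUV.Beta.MultiscaleSupMemberNested` — engine file 11 (two thin ENDs, BY NAME): the Laplacian member
# (3.42)₄'s SHAPE and — modulo the typed local-regularity datum — the sup member (3.42)₁'s SHAPE for the MODEL operator `levelOp`
# over print's (2.1)–(2.2)-SHAPED DATA: a cube partition with levels `e` (`S_l = L^{e_l}`) and ONE sup-metric separation constant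
# `R′` of non-adjacent level sets — co-owner beta-d4-p3's `MultiscaleNestedGrading.abs_level_sub_le` (the additive grading is a
# THEOREM of the separation, `A = 1`) composed with files 9b∕10b

HONEST FRAMING (page 1 of everything in this cell).  Discharging `FlowStep.BetaPertH` would make Bałaban's ultraviolet
stability UNCONDITIONAL — a constructive-QFT result; it is NOT the continuum limit and NOT the Clay problem.  This module
discharges nothing of `BetaPertH`; it is [folklore] bookkeeping (two compositions, no new estimate), kernel-checked, by the OWNER
of binder row D4 (unit `b2b-balaban-beta-an4`, gen 44).  HONEST DEPENDENCY: continuum YM on T⁴ ⇐ BetaPertH ∧ nine spine estimates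
(0/9 proved); BetaPertH ⇐ (D1) ∧ (D4) ∧ CAP+tail; G-an2-4 gates asym, D1 and NE2/3/4.

WHAT IS CERTIFIED (kernel, 0 sorry), in the analytic setting of `MultiscaleDecay.hc_levelOp` with GRADED level sides `S_l = L^{e_l}`
(`1 ≤ L`) and the SEPARATION (SEP) «`e(x) ≤ j − 1 ∧ e(y) ≥ j + 1 ⟹ dist(x,y) ≥ R′·L^j + 1`» for the site levels `e(x) := e_{l_{cellOf x}}`
(`R′ > 0`; [B6] (2.2) SHAPE «(L^jη)⁻¹dist(Ω^c_j, Ω_{j+1}) > RM» with `Ω_j := {e ≥ j}`, `R′ = RM` — a LOCATOR of the hypothesis shape):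
* **`real_lap_levelOp_inverse_le_of_nesting`** — for `u` supported in cell `k′` with `|u| ≤ m` and `x` in cell `k`:
  `|((D*D)(levelOp)⁻¹u)(x,i)| ≤ (1 + a_max·√|Cp|·L·√(L^d)·e^{4dκ}/μ₀)·e^{−(κ − (1+d/2)·log L/R′)·d_n(t_k,t_{k′})}·m` — (3.42)₄'s SHAPE
  with NO analytic datum at all: DATA = {cube partition with levels, `R′`}, constants `d, c, a, C, κ, L, R′, |Cp|` (file 10b
  `real_lap_levelOp_inverse_le_graded` at `A = 1` ∘ `abs_level_sub_le` at the two corners);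
* **`real_sup_levelOp_inverse_le_of_nesting`** — under the LOCAL-REGULARITY DATUM `hreg` of file 9b (O.2 item (ii-b), a
  HYPOTHESIS) and `(1 + d/2)·log L/R′ ≤ κ`: `|((levelOp)⁻¹u)(x,i)| ≤ (c₁K₁ + c₂K₂)·n(x)²·e^{−(κ − (1+d/2)·log L/R′)·d_n(x,t_{k′})}·m`
  with `K₁ = √|Cp|·e^{κ(ρ₀+2d)}·(L·e^{(log L/R′)ρ₀})·L·√(L^d)/μ₀`, `K₂ = e^{(κ−(1+d/2)log L/R′)(ρ₀+2d)}` — (3.42)₁'s SHAPE sitewise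
  (file 9b `real_sup_levelOp_inverse_le_of_regularity` at `A = 1` ∘ `abs_level_sub_le` sitewise).
So for the MODEL: the Laplacian member holds over print's geometric data ALONE; the sup member over the same data PLUS `hreg`.

LOCATORS (shape only, nothing printed asserted; ABSOLUTE RULE): [Balaban1985BackgroundPropagators] Thm 3.1 (3.42) p. 397;
[Balaban1984PropagatorsII] (2.1)–(2.2) p. 224, (2.46) p. 231.  Row D4: NO class change (critical-path width 0; `hreg` NOT discharged;
D4 DISCHARGE NO DATE); NOT BetaPertH, NOT continuum, NOT Clay, NOT summit progress.
-/

open scoped BigOperators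
open Finset

namespace Summit.QuantumFields.BalabanUV.Beta.MultiscaleSupMemberNested

open Summit.QuantumFields.BalabanUV.Beta.MultiscaleLaplacianMember (real_lap_levelOp_inverse_le_graded)
open Summit.QuantumFields.BalabanUV.Beta.MultiscaleSupMember (real_sup_levelOp_inverse_le_of_regularity)
open Summit.QuantumFields.BalabanUV.Beta.MultiscaleNestedGrading (abs_level_sub_le)
open Summit.QuantumFields.BalabanUV.Beta.MultiscaleCombesThomasL2CellsGraded (siteScale_ctrU)
open Summit.QuantumFields.BalabanUV.Beta.BoxPoincare (Box)
open Summit.QuantumFields.BalabanUV.Beta.MultiscaleCoerciveTorus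
open Summit.QuantumFields.BalabanUV.Beta.MultiscaleDistance
open Summit.QuantumFields.BalabanUV.Beta.MultiscaleDecayBudget
open Literature.MathematicalPhysics.QuantumFieldTheory.Balaban1983to89
open Literature.MathematicalPhysics.QuantumFieldTheory.Balaban1983to89.B9Thm37Glue (covD covDT)
open Literature.MathematicalPhysics.QuantumFieldTheory.Balaban1983to89.B9Thm37GluePU (bsrc btgt)
open Literature.MathematicalPhysics.QuantumFieldTheory.Balaban1983to89.B9Thm37GlueTorusCov (tblk)
open Literature.MathematicalPhysics.QuantumFieldTheory.Balaban1983to89.B9Thm37GlueTorusCovLevels (levelOp)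
open B5TorusCover (UT Ctr ctrU)

noncomputable section

variable {d : ℕ} {N : Fin d → ℕ} [∀ i, NeZero (N i)] [NeZero d] {Cp J K : Type} [Fintype Cp] [DecidableEq Cp] [Nonempty Cp]
  [Fintype J] [Fintype K] [DecidableEq K] (S : J → ℕ) (hS : ∀ l, 1 ≤ S l) (hdivS : ∀ l i, S l ∣ N i) (lvl : K → J)
  (zc : (k : K) → Ctr N (S (lvl k)))

/-! ## The analytic setting of `MultiscaleDecay.hc_levelOp`, as section variables (as in files 7–10) -/

variable
    (hdisj : ∀ k k' v v', cellPt S hS hdivS lvl zc k v = cellPt S hS hdivS lvl zc k' v' → k = k')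
    (hcover : ∀ x : UT N, ∃ k, ∃ v : Box d (S (lvl k)), cellPt S hS hdivS lvl zc k v = x)
    (Rm : UT N × Fin d → Cp → Cp → ℝ) (hRm : ∀ b i j, ∑ k, Rm b k i * Rm b k j = if i = j then (1 : ℝ) else 0)
    (T : J → UT N → Cp → Cp → ℝ) (hT : ∀ l x i i', ∑ k, T l x k i * T l x k i' = if i = i' then (1 : ℝ) else 0)
    (a : J → ℝ) (ha : ∀ j, 0 ≤ a j) (ω : J → UT N → ℝ)
    (hsupp : ∀ l x, ω l (ctrU N (S l) (tblk (hS l) (hdivS l) x)) ≠ 0 → ∃ k v, lvl k = l ∧ cellPt S hS hdivS lvl zc k v = x)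
    {amax : ℝ} (hamax : 0 ≤ amax)
    (hscale : ∀ k, a (lvl k) * ω (lvl k) (ctrU N (S (lvl k)) (zc k)) ^ 2 * (S (lvl k) : ℝ) ^ d ≤ amax / (S (lvl k) : ℝ) ^ 2)
    (c : UT N × Fin d → ℝ) {cmax : ℝ} (hc : ∀ b, |c b| ≤ cmax) {C : ℝ}
    (hcoer : ∀ f : UT N × Cp → ℝ,
      C * ∑ k, ((S (lvl k) : ℝ) ^ 2)⁻¹ * ∑ v : Box d (S (lvl k)), ∑ i, f (cellPt S hS hdivS lvl zc k v, i) ^ 2 ≤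
        ∑ p, f p * levelOp bsrc btgt c Rm (fun l x => ctrU N (S l) (tblk (hS l) (hdivS l) x))
          (fun l x => ω l (ctrU N (S l) (tblk (hS l) (hdivS l) x))) T a f p)
    {κ : ℝ} (hκ0 : 0 ≤ κ) (hκ1 : κ ≤ 1)

include hdisj hRm hT ha hsupp hamax hscale hc hcoer hκ0 hκ1

/-- **THE LAPLACIAN MEMBER (3.42)₄'s SHAPE OVER THE (2.1)–(2.2)-SHAPED DATA — no analytic datum.**  Graded level sides
`S_l = L^{e_l}` (`1 ≤ L`), the separation (SEP) of non-adjacent site-level sets with constant `R′ > 0`; `u` supported in cell `k′` with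
`|u| ≤ m`; `p = (x,i)` with `x` in cell `k`.  Then `|((D*D)((levelOp)⁻¹u))(p)| ≤
(1 + a_max·√|Cp|·L¹·√((L¹)^d)·e^{4dκ}/μ₀)·e^{−(κ − (1+d/2)·log L/R′)·d_n(t_k,t_{k′})}·m` — file 10b at `A = 1`, its cell datum supplied by
beta-d4-p3's `abs_level_sub_le` at the two corners. [cite: Balaban1985BackgroundPropagators, Thm 3.1 (3.42) p.397; Balaban1984PropagatorsII, (2.1)-(2.2) p.224] [folklore] -/
theorem real_lap_levelOp_inverse_le_of_nesting
    (hμ : 0 < C - 2 * d * cmax ^ 2 * κ ^ 2 - amax * (Real.exp (2 * d * κ) - 1))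
    {L : ℕ} (hL : 1 ≤ L) (e : J → ℕ) (hSe : ∀ l, S l = L ^ e l) {R' : ℝ} (hR' : 0 < R')
    (hsep : ∀ (j : ℕ) (x y : UT N), e (lvl (cellOf S hS hdivS lvl zc hcover x)) + 1 ≤ j →
      j + 1 ≤ e (lvl (cellOf S hS hdivS lvl zc hcover y)) → R' * (L : ℝ) ^ j + 1 ≤ dist x y)
    (k k' : K) (u : UT N × Cp → ℝ) (hu : ∀ p, cellOf S hS hdivS lvl zc hcover p.1 ≠ k' → u p = 0)
    {m : ℝ} (hm : 0 ≤ m) (hum : ∀ p, |u p| ≤ m) (p : UT N × Cp) (hpk : cellOf S hS hdivS lvl zc hcover p.1 = k) :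
    |covDT bsrc btgt c Rm (covD bsrc btgt c Rm
        ((Ring.inverse (levelOp bsrc btgt c Rm (fun l x => ctrU N (S l) (tblk (hS l) (hdivS l) x))
          (fun l x => ω l (ctrU N (S l) (tblk (hS l) (hdivS l) x))) T a)) u)) p| ≤
      (1 + amax * Real.sqrt (Fintype.card Cp) * (L : ℝ) ^ (1 : ℕ) * Real.sqrt (((L : ℝ) ^ (1 : ℕ)) ^ d) * Real.exp (4 * d * κ) /
          (C - 2 * d * cmax ^ 2 * κ ^ 2 - amax * (Real.exp (2 * d * κ) - 1))) *
        Real.exp (-((κ - (1 + d / 2) * (Real.log L / R')) *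
          sdist bsrc btgt (siteScale S hS hdivS lvl zc hcover) (ctrU N (S (lvl k)) (zc k)) (ctrU N (S (lvl k')) (zc k')))) * m := by
  -- the site grading of the scale
  have hgr : ∀ x, siteScale S hS hdivS lvl zc hcover x = L ^ (e (lvl (cellOf S hS hdivS lvl zc hcover x))) := fun x => by
    rw [siteScale, hSe]
  -- the additive datum at the two corners, from the separation (beta-d4-p3)
  have hadd := abs_level_sub_le (fun x => e (lvl (cellOf S hS hdivS lvl zc hcover x))) (siteScale S hS hdivS lvl zc hcover) hL hgr
    hR' hsep (ctrU N (S (lvl k)) (zc k)) (ctrU N (S (lvl k')) (zc k'))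
  have hk : cellOf S hS hdivS lvl zc hcover (ctrU N (S (lvl k)) (zc k)) = k := by
    rw [← cubePt_zero (hS (lvl k)) (hdivS (lvl k)) (zc k)]
    exact cellOf_cellPt S hS hdivS lvl zc hdisj hcover k _
  have hk' : cellOf S hS hdivS lvl zc hcover (ctrU N (S (lvl k')) (zc k')) = k' := by
    rw [← cubePt_zero (hS (lvl k')) (hdivS (lvl k')) (zc k')]
    exact cellOf_cellPt S hS hdivS lvl zc hdisj hcover k' _
  simp only [hk, hk'] at hadd
  exact real_lap_levelOp_inverse_le_graded S hS hdivS lvl zc hdisj hcover Rm hRm T hT a ha ω hsupp hamax hscale c hc hcoer hκ0 hκ1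
    hμ hL e hSe hR' (A := 1) k k' hadd u hu hm hum p hpk

/-- **THE SUP MEMBER (3.42)₁'s SHAPE OVER THE (2.1)–(2.2)-SHAPED DATA, MODULO THE LOCAL-REGULARITY DATUM.**  Same data +
`(1 + d/2)·log L/R′ ≤ κ` + file 9b's `hreg` (constants `c₁, c₂ ≥ 0`, radius `ρ₀`; O.2 item (ii-b) — a HYPOTHESIS); then for `u` supported
in cell `k′` with `|u| ≤ m` and every `p = (x,i)`: `|((levelOp)⁻¹u)(p)| ≤ (c₁K₁ + c₂K₂)·n(x)²·e^{−(κ − (1+d/2)·log L/R′)·d_n(x,t_{k′})}·m`,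
`K₁ = √|Cp|·e^{κ(ρ₀+2d)}·(L¹e^{(log L/R′)ρ₀})·L¹·√((L¹)^d)/μ₀`, `K₂ = e^{(κ − (1+d/2)log L/R′)(ρ₀+2d)}` — file 9b at `A = 1`, its sitewise
datum = `abs_level_sub_le`. [cite: Balaban1985BackgroundPropagators, Thm 3.1 (3.42) p.397; Balaban1984PropagatorsII, (2.1)-(2.2) p.224] [folklore] -/
theorem real_sup_levelOp_inverse_le_of_nesting
    (hμ : 0 < C - 2 * d * cmax ^ 2 * κ ^ 2 - amax * (Real.exp (2 * d * κ) - 1))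
    {L : ℕ} (hL : 1 ≤ L) (e : J → ℕ) (hSe : ∀ l, S l = L ^ e l) {R' : ℝ} (hR' : 0 < R')
    (hsep : ∀ (j : ℕ) (x y : UT N), e (lvl (cellOf S hS hdivS lvl zc hcover x)) + 1 ≤ j →
      j + 1 ≤ e (lvl (cellOf S hS hdivS lvl zc hcover y)) → R' * (L : ℝ) ^ j + 1 ≤ dist x y)
    (hrate : (1 + d / 2) * (Real.log L / R') ≤ κ)
    {c₁ c₂ ρ₀ : ℝ} (hc₁ : 0 ≤ c₁) (hc₂ : 0 ≤ c₂)
    (hreg : ∀ (f : UT N × Cp → ℝ) (p : UT N × Cp) (m' : ℝ),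
      (∀ q : UT N × Cp, sdist bsrc btgt (siteScale S hS hdivS lvl zc hcover) q.1 p.1 ≤ ρ₀ →
        |levelOp bsrc btgt c Rm (fun l x => ctrU N (S l) (tblk (hS l) (hdivS l) x))
          (fun l x => ω l (ctrU N (S l) (tblk (hS l) (hdivS l) x))) T a f q| ≤ m') →
      |f p| ≤ c₁ * Real.sqrt (((siteScale S hS hdivS lvl zc hcover p.1 : ℝ) ^ d)⁻¹ *
          ∑ q ∈ univ.filter (fun q : UT N × Cp => sdist bsrc btgt (siteScale S hS hdivS lvl zc hcover) q.1 p.1 ≤ ρ₀), f q ^ 2) +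
        c₂ * (siteScale S hS hdivS lvl zc hcover p.1 : ℝ) ^ 2 * m')
    (k' : K) (u : UT N × Cp → ℝ) (hu : ∀ p, cellOf S hS hdivS lvl zc hcover p.1 ≠ k' → u p = 0)
    {m : ℝ} (hm : 0 ≤ m) (hum : ∀ p, |u p| ≤ m) (p : UT N × Cp) :
    |(Ring.inverse (levelOp bsrc btgt c Rm (fun l x => ctrU N (S l) (tblk (hS l) (hdivS l) x))
        (fun l x => ω l (ctrU N (S l) (tblk (hS l) (hdivS l) x))) T a)) u p| ≤
      (c₁ * (Real.sqrt (Fintype.card Cp) * Real.exp (κ * (ρ₀ + 2 * d)) *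
            ((L : ℝ) ^ (1 : ℕ) * Real.exp (Real.log L / R' * ρ₀)) * (L : ℝ) ^ (1 : ℕ) * Real.sqrt (((L : ℝ) ^ (1 : ℕ)) ^ d) /
            (C - 2 * d * cmax ^ 2 * κ ^ 2 - amax * (Real.exp (2 * d * κ) - 1))) +
          c₂ * Real.exp ((κ - (1 + d / 2) * (Real.log L / R')) * (ρ₀ + 2 * d))) *
        (siteScale S hS hdivS lvl zc hcover p.1 : ℝ) ^ 2 *
        Real.exp (-((κ - (1 + d / 2) * (Real.log L / R')) *
          sdist bsrc btgt (siteScale S hS hdivS lvl zc hcover) p.1 (ctrU N (S (lvl k')) (zc k')))) * m := by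
  have hgr : ∀ x, siteScale S hS hdivS lvl zc hcover x = L ^ (e (lvl (cellOf S hS hdivS lvl zc hcover x))) := fun x => by
    rw [siteScale, hSe]
  have hadd : ∀ x y : UT N, |(e (lvl (cellOf S hS hdivS lvl zc hcover x)) : ℝ) - e (lvl (cellOf S hS hdivS lvl zc hcover y))| ≤
      ((1 : ℕ) : ℝ) + sdist bsrc btgt (siteScale S hS hdivS lvl zc hcover) x y / R' := fun x y =>
    abs_level_sub_le (fun x => e (lvl (cellOf S hS hdivS lvl zc hcover x))) (siteScale S hS hdivS lvl zc hcover) hL hgr hR' hsep x y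
  exact real_sup_levelOp_inverse_le_of_regularity S hS hdivS lvl zc hdisj hcover Rm hRm T hT a ha ω hsupp hamax hscale c hc hcoer
    hκ0 hκ1 hμ hL e hSe hR' (A := 1) hadd hrate hc₁ hc₂ hreg k' u hu hm hum p

end

end Summit.QuantumFields.BalabanUV.Beta.MultiscaleSupMemberNested
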